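/-
Origin: expansion seat `planner-pub-hodgecm-toy-g3-0`, handover #5 v2 2026-08-18T12:03Z (md5 9b3343af) (`HOME/pub-hodgecm-toy-g3/lean/ToyG3/DescentFactsAll3.lean`, md5 9b3343af, 111 lines);
landed by the gen-8 packager in gate run 29 as `HodgeCM/Model/ToyG2/DescentFactsAll3.lean` (import ^import ToyG3\.DescentFacts3[ \t]*$→import HodgeCM.Model.ToyG2.DescentFacts3 ×1).
-/
/-
Copyright: pub-hodgecm formalisation cell (harness21, 2026). New file (not vendored).
Origin: session planner-pub-hodgecm-toy-g3-0 (unit pub-hodgecm-toy-g3, EXPANSION part (e) CONSISTENCY WITNESS, gen 3 of the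
lineage toy → toy-g2 → toy-g3), 2026-08-18.  WIP module `ToyG3.DescentFactsAll3`; intended final place
`HodgeCM/Model/ToyG2/DescentFactsAll3.lean` (module `HodgeCM.Model.ToyG2.DescentFactsAll3`; kind L5, toy model / consistency
witness — ONE NEW ADDITIVE FILE, no landed file is touched).  ONE WIP import to rewrite on landing:
`import ToyG3.DescentFacts3` ↦ `import HodgeCM.Model.ToyG2.DescentFacts3` (this seat, same handover; LAND ORDER: after it);
`HodgeCM.Model.ToyG2.SplitAllGood` is pv03-g6's (md5 c679c320), in the tree since gate run 28, imported by its FINAL name.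
-/
import Mathlib
import Summits.HodgeConjecture.HodgeCM.Model.ToyG2.DescentFacts3_2
import Summits.HodgeConjecture.HodgeCM.Model.ToyG2.SplitAllGood

/-!
# The trace-free [QW8] route's complete hypothesis set is satisfiable — unconditionally

`HodgeCM.Model.ToyG2.DescentFacts3` establishes, in toy-g2's universe `toyUniverse₃ d t` (`1 ≤ d`, `t² = 16`) and GIVEN its
model axioms, all ten binders of `Assembly.COR_CM_of_descentFactsB₄` (`ModelAxioms`, `RealisationExistsFace`, N1, N2, F4,
F5, F-H0, F7d-B, `Fact_dimProd`), and the joint witness modulo the displayed model axiom M26.  pv03-g6's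
`HodgeCM.Model.ToyG2.SplitAllGood` proves all 28 model axioms of `toyUniverse₃ d t` outright
(`toyUniverse₃_modelAxioms_all`).  Combining:

* `toyUniverse₃_descentFactsB₄_all d t hd ht`, `toyUniverse₃_descentFacts₄_all d t hd ht`,
  `toyUniverse₃_descentProfile_all d t hd ht` — the binder lists with no hypothesis left;
* `exists_descentFactsB₄_inputs : ∃ U, ModelAxioms ∧ RealisationExistsFace ∧ N1 ∧ N2 ∧ F4 ∧ F5 ∧ F-H0 ∧ F7d-B ∧ Fact_dimProd`
  — the TEN binders of `Assembly.COR_CM_of_descentFactsB₄` in ONE universe (`toyUniverse₃ 1 4`); generation 1 had the nine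
  generic ones without the realisation (`HodgeCM.Toy.descentFactsB_consistent`), in a model where the realisation fails;
* `exists_descentFacts₄_inputs` — the same for `Assembly.COR_CM_of_descentFacts₄` (F7d form, `Fact_pull_H0_cmProd`);
* `exists_descentFactsAll_inputs` — one universe with the model axioms, BOTH realisations, N1–N4, F4, F5, F-H0, F7d, F7d-B,
  `Fact_dimProd` and `Fact_pull_H0_cmProd`: the union of the hypothesis sets of every trace-free [QW8]-side end-to-end
  theorem of the package (`COR_CM_of_descentFacts`, `…'`, `…B`, `…₃`, `…B₃`, `…B_eq₃`, `…₄`, `…B₄`, `…B₃_of₄`) and of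
  `perL_of_openInputs`' realisation input, satisfied simultaneously.

WHAT THIS SHOWS / DOES NOT SHOW: as in `DescentFacts3` — satisfiability of the hypothesis sets by one explicit structure with
nonempty realisations (so no input of these routes is refutable from the others, and their end states are not vacuous);
nothing about complex projective varieties, where `RealisationExistsFace` is OPEN and the F-facts are the print-anchored
inputs catalogued in `FACTS.md`.  The trace-DEPENDENT inputs F6 `Fact_weightDual` / F7 (ii) / `Fact_trTop` of the older
geometric route (`Assembly/OpenInputsGeometric.lean`) are NOT witnessed here.  Everything is kernel-proved from the tree;
no citation, nothing posited.
-/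

noncomputable section

namespace HodgeCM.ToyG2

open HodgeCM.Toy

section ToyUniverse

variable (d t : ℚ) (hd : 1 ≤ d) (ht : t ^ 2 = 16)
include hd ht

/-- The ten binders of `Assembly.COR_CM_of_descentFactsB₄` in `toyUniverse₃ d t`, no hypothesis left. -/
theorem toyUniverse₃_descentFactsB₄_all :
    (toyUniverse₃ d t).ModelAxioms ∧ (toyUniverse₃ d t).RealisationExistsFace ∧ (toyUniverse₃ d t).Fact_cupExterior ∧
      (toyUniverse₃ d t).Fact_cup_hodge ∧ (toyUniverse₃ d t).Fact_cupAlg ∧ (toyUniverse₃ d t).Fact_cupAssoc ∧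
      (toyUniverse₃ d t).Fact_unitH0 ∧ (toyUniverse₃ d t).Fact_gysinDescentB ∧ (toyUniverse₃ d t).Fact_dimProd :=
  toyUniverse₃_descentFactsB₄ d t hd ht (toyUniverse₃_modelAxioms_all d t)

/-- The ten binders of `Assembly.COR_CM_of_descentFacts₄` in `toyUniverse₃ d t`, no hypothesis left. -/
theorem toyUniverse₃_descentFacts₄_all :
    (toyUniverse₃ d t).ModelAxioms ∧ (toyUniverse₃ d t).RealisationExistsFace ∧ (toyUniverse₃ d t).Fact_cupExterior ∧
      (toyUniverse₃ d t).Fact_cup_hodge ∧ (toyUniverse₃ d t).Fact_pull_H0_cmProd ∧ (toyUniverse₃ d t).Fact_cupAlg ∧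
      (toyUniverse₃ d t).Fact_cupAssoc ∧ (toyUniverse₃ d t).Fact_gysinDescent ∧ (toyUniverse₃ d t).Fact_dimProd :=
  toyUniverse₃_descentFacts₄ d t hd ht (toyUniverse₃_modelAxioms_all d t)

/-- Everything at once in `toyUniverse₃ d t`, no hypothesis left: model axioms · both realisations · N1–N4 · F4, F5, F-H0,
F7d, F7d-B, `Fact_dimProd`, `Fact_pull_H0_cmProd`. -/
theorem toyUniverse₃_descentProfile_all :
    (toyUniverse₃ d t).ModelAxioms ∧
      ((toyUniverse₃ d t).RealisationExistsPerL ∧ (toyUniverse₃ d t).RealisationExistsFace) ∧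
      ((toyUniverse₃ d t).Fact_cupExterior ∧ (toyUniverse₃ d t).Fact_cup_hodge ∧ (toyUniverse₃ d t).Fact_pull_H0 ∧
        (toyUniverse₃ d t).Fact_hodge_F0) ∧
      ((toyUniverse₃ d t).Fact_cupAlg ∧ (toyUniverse₃ d t).Fact_cupAssoc ∧ (toyUniverse₃ d t).Fact_unitH0 ∧
        (toyUniverse₃ d t).Fact_gysinDescent ∧ (toyUniverse₃ d t).Fact_gysinDescentB ∧ (toyUniverse₃ d t).Fact_dimProd ∧
        (toyUniverse₃ d t).Fact_pull_H0_cmProd) :=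
  toyUniverse₃_descentProfile d t hd ht (toyUniverse₃_modelAxioms_all d t)

end ToyUniverse

/-- **JOINT WITNESS (referee A item G4, trace-free [QW8] route): the TEN binders of `Assembly.COR_CM_of_descentFactsB₄`
hold in ONE universe** — `ModelAxioms ∧ RealisationExistsFace ∧ N1 ∧ N2 ∧ F4 ∧ F5 ∧ F-H0 ∧ F7d-B ∧ Fact_dimProd`, witness
`toyUniverse₃ 1 4`.  (Generation 1, `HodgeCM.Toy.descentFactsB_consistent`: the nine generic binders only, in `toyModel`,
where the realisation input is false.) -/
theorem exists_descentFactsB₄_inputs :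
    ∃ U : Universe, U.ModelAxioms ∧ U.RealisationExistsFace ∧ U.Fact_cupExterior ∧ U.Fact_cup_hodge ∧ U.Fact_cupAlg ∧
      U.Fact_cupAssoc ∧ U.Fact_unitH0 ∧ U.Fact_gysinDescentB ∧ U.Fact_dimProd :=
  ⟨toyUniverse₃ 1 4, toyUniverse₃_descentFactsB₄_all 1 4 le_rfl (by norm_num)⟩

/-- The ten binders of `Assembly.COR_CM_of_descentFacts₄` (F7d form) hold in one universe. -/
theorem exists_descentFacts₄_inputs :
    ∃ U : Universe, U.ModelAxioms ∧ U.RealisationExistsFace ∧ U.Fact_cupExterior ∧ U.Fact_cup_hodge ∧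
      U.Fact_pull_H0_cmProd ∧ U.Fact_cupAlg ∧ U.Fact_cupAssoc ∧ U.Fact_gysinDescent ∧ U.Fact_dimProd :=
  ⟨toyUniverse₃ 1 4, toyUniverse₃_descentFacts₄_all 1 4 le_rfl (by norm_num)⟩

/-- **One universe for every trace-free binder list at once**: model axioms, BOTH realisations, N1–N4, F4, F5, F-H0, F7d,
F7d-B, `Fact_dimProd`, `Fact_pull_H0_cmProd`. -/
theorem exists_descentFactsAll_inputs :
    ∃ U : Universe, U.ModelAxioms ∧ (U.RealisationExistsPerL ∧ U.RealisationExistsFace) ∧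
      (U.Fact_cupExterior ∧ U.Fact_cup_hodge ∧ U.Fact_pull_H0 ∧ U.Fact_hodge_F0) ∧
      (U.Fact_cupAlg ∧ U.Fact_cupAssoc ∧ U.Fact_unitH0 ∧ U.Fact_gysinDescent ∧ U.Fact_gysinDescentB ∧ U.Fact_dimProd ∧
        U.Fact_pull_H0_cmProd) :=
  ⟨toyUniverse₃ 1 4, toyUniverse₃_descentProfile_all 1 4 le_rfl (by norm_num)⟩

/-- … hence `HC_CM` of `toyUniverse₃ 1 4` by the trace-free end-to-end theorem with every binder a theorem of the model. -/
theorem toyUniverse₃_hcCM_by_descentB₄_all : (toyUniverse₃ 1 4).HC_CM :=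
  toyUniverse₃_hcCM_by_descentB₄ 1 4 le_rfl (by norm_num) (toyUniverse₃_modelAxioms_all 1 4)

end HodgeCM.ToyG2

end
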